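import Mathlib
import HarnessLib
import Literature.Analysis.FluidPDE.VectorCalculus
import Literature.Analysis.FluidPDE.VorticityCalculus
import Literature.Analysis.FluidPDE.CaloricRemainderCalculus
import Literature.Analysis.FluidPDE.LerayProfileCalculus
import Summits.NavierStokesRegularity.NavierStokesRegularity.Theorems.ThreadingFluxHorizonTowerPoloidalFieldCalculus
import Summits.NavierStokesRegularity.NavierStokesRegularity.Theorems.UnthreadedDoorAntidynamoSolidHarmonicProfile

/-!
# Route `UnthreadedDoor` / `ThreadingFlux`, crux `PoloidalLiouville` (stmt-NavierStokesRegularity-1222), antidynamo v2 skeleton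
# (sha16 `4ebf5683127b`), rung `stub_singleDegreeRung` (BC5), step S4 ingredients: the toroidal field `Λ = ∇Q × id` of a harmonic,
# positively homogeneous profile is a HARMONIC vector field, HOMOGENEOUS of the same degree (`ΔΛ = 0`, `DΛ(y)[y] = l Λ(y)`)

Support file (seat leafhand-ns-unthreadeddoor-1 g0, cell decomp-ns), `--supports stmt-NavierStokesRegularity-1222 --as helper`; theorems only.
Step S4 of the independent-rung plan computes `Δ(G(t,‖y‖) Λ(y)) = (∂ᵣ²G + (2l+2) r⁻¹ ∂ᵣG) Λ`; by the local product rule (p797439,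
`laplacian_smul_field_of_contDiffOn`) this needs exactly `ΔΛ = 0` and the Euler identity `DΛ(y)[y] = l Λ(y)`, proved here:

* `laplacian_smul_id` — `Δ(Q • id) = 2 ∇Q + (ΔQ) • id` for `Q ∈ C²`.
* ★ `laplacian_cross_gradient_eq_zero` — `Δ(∇Q × id) ≡ 0` for `Q ∈ C³` harmonic: `∇Q × id = curl (Q • id)` (tree `PoloidalField.curl_smul_self`),
  `Δ curl = curl Δ` (tree `curl_laplacian`), `Δ(Q • id) = 2∇Q`, `curl ∇Q = 0`.
* ★ `fderiv_cross_gradient_apply_self` — `D(∇Q × id)(y)[y] = l • (∇Q × id)(y)` for `Q ∈ C²` positively homogeneous of degree `l`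
  (Euler, tree `PoloidalField.fderiv_apply_self_of_homogeneous` + this hand's ray scaling `cross_gradient_smul_of_homogeneous`).

HONEST LABEL: calculus; nothing here bears on `PoloidalLiouville` (1222) or NS regularity. [folklore]
-/

noncomputable section

-- the summit and its single sub-problem share the name (CONVENTIONS §1)
set_option linter.dupNamespace false

open scoped Topology InnerProductSpace RealInnerProductSpace ContDiff Laplacian
open Filter Set Function Metric
open Literature.Analysis.FluidPDE

namespace Summit.NavierStokesRegularity.NavierStokesRegularity.Theorems.PoloidalLiouville.Antidynamo

/-- The gradient of a `C²` scalar is `C¹`, in particular differentiable. [folklore] -/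
theorem differentiable_gradient_of_contDiff_two {Q : EuclideanSpace ℝ (Fin 3) → ℝ} (hQ : ContDiff ℝ 2 Q) :
    Differentiable ℝ (gradient Q) := by
  have h1 : ContDiff ℝ 1 (fderiv ℝ Q) := hQ.fderiv_right (m := 1) (by norm_cast)
  have : gradient Q = fun y => (InnerProductSpace.toDual ℝ (EuclideanSpace ℝ (Fin 3))).symm (fderiv ℝ Q y) := rfl
  rw [this]
  exact ((InnerProductSpace.toDual ℝ (EuclideanSpace ℝ (Fin 3))).symm.contDiff.comp h1).differentiable one_ne_zero

/-- `Δ(Q • id)(x) = 2 ∇Q(x) + ΔQ(x) • x` for `Q ∈ C²`. [folklore] -/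
theorem laplacian_smul_id {Q : EuclideanSpace ℝ (Fin 3) → ℝ} (hQ : ContDiff ℝ 2 Q) (x : EuclideanSpace ℝ (Fin 3)) :
    (Δ fun y : EuclideanSpace ℝ (Fin 3) => Q y • y) x = (2 : ℝ) • gradient Q x + ((Δ Q) x) • x := by
  rw [laplacian_smul_field (e := fun y : EuclideanSpace ℝ (Fin 3) => y) hQ contDiff_id x, laplacian_id_eq_zero, smul_zero,
    zero_add]
  have : fderiv ℝ (fun y : EuclideanSpace ℝ (Fin 3) => y) x = ContinuousLinearMap.id ℝ _ := fderiv_id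
  rw [this, ContinuousLinearMap.id_apply]

/-- ★ `Δ(∇Q × id) ≡ 0` for a harmonic `Q ∈ C³`: the toroidal field of a harmonic profile is harmonic. [folklore] -/
theorem laplacian_cross_gradient_eq_zero {Q : EuclideanSpace ℝ (Fin 3) → ℝ} (hQ : ContDiff ℝ 3 Q) (hharm : ∀ y, (Δ Q) y = 0)
    (x : EuclideanSpace ℝ (Fin 3)) : (Δ fun y : EuclideanSpace ℝ (Fin 3) => cross (gradient Q y) y) x = 0 := by
  have hQ2 : ContDiff ℝ 2 Q := hQ.of_le (by norm_cast)
  have hQd : Differentiable ℝ Q := hQ.differentiable (by norm_cast)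
  have hΛ : (fun y : EuclideanSpace ℝ (Fin 3) => cross (gradient Q y) y) = curl (fun z : EuclideanSpace ℝ (Fin 3) => Q z • z) :=
    funext fun y => (PoloidalField.curl_smul_self (hQd y)).symm
  have h3 : ContDiff ℝ 3 fun z : EuclideanSpace ℝ (Fin 3) => Q z • z := hQ.smul contDiff_id
  rw [hΛ, ← curl_laplacian h3 x]
  have hΔ : (Δ fun z : EuclideanSpace ℝ (Fin 3) => Q z • z) = fun y => (2 : ℝ) • gradient Q y := by
    funext y
    rw [laplacian_smul_id hQ2 y, hharm y, zero_smul, add_zero]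
  rw [hΔ, curl_const_smul (differentiable_gradient_of_contDiff_two hQ2 x), curl_gradient_eq_zero_holds Q hQ2 x, smul_zero]

/-- ★ EULER IDENTITY for the toroidal field: `D(∇Q × id)(y)[y] = l • (∇Q × id)(y)` for `Q ∈ C²` positively homogeneous of degree `l`
(so `(y·∇)Λ = lΛ`). [folklore] -/
theorem fderiv_cross_gradient_apply_self {Q : EuclideanSpace ℝ (Fin 3) → ℝ} (hQ : ContDiff ℝ 2 Q) {l : ℕ}
    (hhom : ∀ r : ℝ, 0 < r → ∀ y : EuclideanSpace ℝ (Fin 3), Q (r • y) = r ^ l * Q y) (y : EuclideanSpace ℝ (Fin 3)) :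
    fderiv ℝ (fun z : EuclideanSpace ℝ (Fin 3) => cross (gradient Q z) z) y y = (l : ℝ) • cross (gradient Q y) y := by
  have hQd : Differentiable ℝ Q := hQ.differentiable (by norm_cast)
  have hΛd : DifferentiableAt ℝ (fun z : EuclideanSpace ℝ (Fin 3) => cross (gradient Q z) z) y := by
    have : (fun z : EuclideanSpace ℝ (Fin 3) => cross (gradient Q z) z) = fun z => crossCLM (gradient Q z) z := by
      funext z; rw [crossCLM_apply]
    rw [this]
    exact ((crossCLM.contDiff.comp ((InnerProductSpace.toDual ℝ (EuclideanSpace ℝ (Fin 3))).symm.contDiff.comp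
      (hQ.fderiv_right (m := 1) (by norm_cast)))).clm_apply contDiff_id).differentiable one_ne_zero y
  have ha : HasDerivAt (fun c : ℝ => c ^ l) (l : ℝ) 1 := by
    simpa using hasDerivAt_pow l (1 : ℝ)
  refine PoloidalField.fderiv_apply_self_of_homogeneous hΛd ha ?_
  filter_upwards [Ioi_mem_nhds (zero_lt_one' ℝ)] with c hc
  rw [cross_gradient_smul_of_homogeneous hQd hhom hc y]

end Summit.NavierStokesRegularity.NavierStokesRegularity.Theorems.PoloidalLiouville.Antidynamo

end
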